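import Summits.CriticalPhenomena.PercolationContinuityZ3.Theorems.SahiMasterFamilyRigidityR3Prelim

/-!
# Rigidity R₃, steps (a) and (b): the identity in `ℝ[X_ι]`, no triply-essential coordinate, the `X_x²`-coefficient, sections of the identity

Support file of the master-family programme (crux `NoHeavyLowerTail`, stmt-CriticalPhenomena-4575; cell `prim-masterthm`, seat P4,
unit `prim-masterthm-p4-g7`).  Seat document HOME/prim-masterthm-p4/EQI3-RIGIDITY-PROOF.md §3 (a), (b), (c-reduction).  Second of three files.
For the identity `Identity P₁ P₂ U` (`E(1_{P₁})E(1_{P₂}1_U) + E(1_{P₂})E(1_{P₁}1_U) = E(1_{P₁})E(1_{P₂})E(1_U)` at every interior `p`):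
`poly_identity` (the same in `ℝ[X_ι]`), `exPoly_mul_dsec_eq` (step (b): for `x` essential for `P₁` and inessential for `P₂`,
`E(1_{P₂}·Δ_x 1_U) = E(1_{P₂})·E(Δ_x 1_U)` — the `X_x²`-coefficient), `not_all_three` (step (a), degree `3` vs `≤ 2`), and `identity_secAt`
(the identity passes to the section `U^{x←1}` at a coordinate inessential for both `P_i`).
HONEST FRAMING: infrastructure; Sahi `C_k` / Kahn's Conj. 5 / the master theorem remain OPEN.  [this work]
-/

noncomputable section

open scoped Classical

namespace Summit.CriticalPhenomena.PercolationContinuityZ3.Theorems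

open Finset Function MvPolynomial
open Literature.Computability.AlgebraicComplexity (blockProfile blockProfile_apply)
open Literature.Combinatorics.Sahi2008
open Literature.Probability.Percolation.BHK2006 (weight)
open Literature.Probability.Percolation.DecisionTree (ind ind_of_mem ind_of_not_mem ind_nonneg)
open SharedCoordinate (Ignores xInd)
open ExpectationRigidity

namespace RigidityR3

variable {ι : Type*} [Fintype ι]

/-! ### The identity as a polynomial identity, and step (b) -/

section Identity

variable {P₁ P₂ U : Set (Set ι)}
  (hI : ∀ p : ι → unitInterval, (∀ e, (p e : ℝ) ∈ Set.Ioo (0 : ℝ) 1) →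
    ex (bernoulliWeight p) (ind P₁) * ex (bernoulliWeight p) (ind P₂ * ind U) +
      ex (bernoulliWeight p) (ind P₂) * ex (bernoulliWeight p) (ind P₁ * ind U) =
    ex (bernoulliWeight p) (ind P₁) * ex (bernoulliWeight p) (ind P₂) * ex (bernoulliWeight p) (ind U))

include hI in
/-- **The identity (I) as an identity in `ℝ[X_ι]`.** [this work] -/
theorem poly_identity :
    exPoly (ind P₁) * exPoly (ind P₂ * ind U) + exPoly (ind P₂) * exPoly (ind P₁ * ind U) =
      exPoly (ind P₁) * exPoly (ind P₂) * exPoly (ind U) := by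
  have hd : ∀ (f : Set ι → ℝ) (i : ι), degreeOf i (exPoly f) ≤ 1 := fun f i => degreeOf_exPoly_le f i
  have hprod : ∀ (f g : Set ι → ℝ) (i : ι), degreeOf i (exPoly f * exPoly g) ≤ 2 := fun f g i =>
    (degreeOf_mul_le i _ _).trans (Nat.add_le_add (hd f i) (hd g i))
  refine mvpoly_eq_of_eval_eq 3 (fun i => ?_) (fun i => ?_) fun x hx => ?_
  · exact (degreeOf_add_le i _ _).trans (max_le ((hprod _ _ i).trans (by norm_num)) ((hprod _ _ i).trans (by norm_num)))
  · exact (degreeOf_mul_le i _ _).trans (Nat.add_le_add (hprod _ _ i) (hd _ i))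
  · simp only [map_add, map_mul, eval_exPoly]
    exact hI (fun i => ⟨x i, (hx i).1.le, (hx i).2.le⟩) hx

include hI in
/-- **Step (b).**  If `x` is inessential for `P₂`, then `E(1_{P₁}^{Δx}) · [E(1_{P₂} · 1_U^{Δx}) − E(1_{P₂}) E(1_U^{Δx})] = 0` in `ℝ[X]`, where
`h^{Δx} = dsec x h` is the signed section difference; hence if `x` is essential for `P₁`: `E(1_{P₂}·1_U^{Δx}) = E(1_{P₂})·E(1_U^{Δx})`. [this work] -/
theorem exPoly_mul_dsec_eq (x : ι) (hx₂ : Ignores x (ind P₂)) (hx₁ : ¬ Ignores x (ind P₁)) :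
    exPoly (ind P₂ * dsec x (ind U)) = exPoly (ind P₂) * exPoly (dsec x (ind U)) := by
  -- decompose everything along `x`
  have hid := poly_identity hI
  set A₀ := exPoly (fsec x false (ind P₁)) with hA₀
  set D := exPoly (dsec x (ind P₁)) with hD
  set B := exPoly (ind P₂) with hB
  set W₀ := exPoly (fsec x false (ind U)) with hW₀
  set W' := exPoly (dsec x (ind U)) with hW'
  set M₀ := exPoly (ind P₂ * fsec x false (ind U)) with hM₀
  set M' := exPoly (ind P₂ * dsec x (ind U)) with hM'
  set N₀ := exPoly (fsec x false (ind P₁ * ind U)) with hN₀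
  set N' := exPoly (dsec x (ind P₁ * ind U)) with hN'
  have hE1 : exPoly (ind P₁) = A₀ + X x * D := by rw [exPoly_eq_fsec x (ind P₁)]; rfl
  have hW : exPoly (ind U) = W₀ + X x * W' := by rw [exPoly_eq_fsec x (ind U)]; rfl
  have hM : exPoly (ind P₂ * ind U) = M₀ + X x * M' := by
    rw [exPoly_eq_fsec x (ind P₂ * ind U), fsec_mul_of_ignores false hx₂, fsec_mul_of_ignores true hx₂, ← mul_sub]; rfl
  have hN : exPoly (ind P₁ * ind U) = N₀ + X x * N' := by rw [exPoly_eq_fsec x (ind P₁ * ind U)]; rfl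
  rw [hE1, hW, hM, hN] at hid
  -- the `X_x²`-part
  have key : X x ^ 2 * (D * (M' - B * W')) =
      -(A₀ * M₀ + X x * (A₀ * M' + D * M₀) + B * N₀ + X x * (B * N') - A₀ * B * W₀ - X x * (A₀ * B * W' + D * B * W₀)) := by
    linear_combination hid
  -- `x`-freeness of the coefficients
  have f0 : ∀ {g : Set ι → ℝ}, Ignores x g → degreeOf x (exPoly g) = 0 := fun hg => degreeOf_exPoly_eq_zero_of_ignores hg
  have hA₀0 : degreeOf x A₀ = 0 := f0 (ignores_fsec x false _)
  have hD0 : degreeOf x D = 0 := f0 (ignores_dsec x _)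
  have hB0 : degreeOf x B = 0 := f0 hx₂
  have hW₀0 : degreeOf x W₀ = 0 := f0 (ignores_fsec x false _)
  have hW'0 : degreeOf x W' = 0 := f0 (ignores_dsec x _)
  have hM₀0 : degreeOf x M₀ = 0 := f0 (hx₂.mul (ignores_fsec x false _))
  have hM'0 : degreeOf x M' = 0 := f0 (hx₂.mul (ignores_dsec x _))
  have hN₀0 : degreeOf x N₀ = 0 := f0 (ignores_fsec x false _)
  have hN'0 : degreeOf x N' = 0 := f0 (ignores_dsec x _)
  have hX : degreeOf x (X x : MvPolynomial ι ℝ) = 1 := by rw [degreeOf_X, if_pos rfl]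
  -- degree of the coefficient and of the lower part
  have hc0 : degreeOf x (D * (M' - B * W')) = 0 := by
    refine Nat.eq_zero_of_le_zero ((degreeOf_mul_le x _ _).trans ?_)
    have := degreeOf_sub_le x M' (B * W'); have := degreeOf_mul_le x B W'; omega
  have hL : degreeOf x (-(A₀ * M₀ + X x * (A₀ * M' + D * M₀) + B * N₀ + X x * (B * N') - A₀ * B * W₀ -
      X x * (A₀ * B * W' + D * B * W₀))) ≤ 1 := by
    rw [degreeOf_neg]
    have t1 := degreeOf_mul_le x A₀ M₀
    have t2 : degreeOf x (X x * (A₀ * M' + D * M₀)) ≤ 1 := (degreeOf_mul_le x _ _).trans (by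
      have := degreeOf_add_le x (A₀ * M') (D * M₀); have := degreeOf_mul_le x A₀ M'; have := degreeOf_mul_le x D M₀; omega)
    have t3 := degreeOf_mul_le x B N₀
    have t4 : degreeOf x (X x * (B * N')) ≤ 1 := (degreeOf_mul_le x _ _).trans (by have := degreeOf_mul_le x B N'; omega)
    have t5 : degreeOf x (A₀ * B * W₀) ≤ 0 := (degreeOf_mul_le x _ _).trans (by have := degreeOf_mul_le x A₀ B; omega)
    have t6 : degreeOf x (X x * (A₀ * B * W' + D * B * W₀)) ≤ 1 := (degreeOf_mul_le x _ _).trans (by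
      have := degreeOf_add_le x (A₀ * B * W') (D * B * W₀); have := degreeOf_mul_le x (A₀ * B) W'; have := degreeOf_mul_le x A₀ B
      have := degreeOf_mul_le x (D * B) W₀; have := degreeOf_mul_le x D B; omega)
    have s1 := degreeOf_add_le x (A₀ * M₀) (X x * (A₀ * M' + D * M₀))
    have s2 := degreeOf_add_le x (A₀ * M₀ + X x * (A₀ * M' + D * M₀)) (B * N₀)
    have s3 := degreeOf_add_le x (A₀ * M₀ + X x * (A₀ * M' + D * M₀) + B * N₀) (X x * (B * N'))
    have s4 := degreeOf_sub_le x (A₀ * M₀ + X x * (A₀ * M' + D * M₀) + B * N₀ + X x * (B * N')) (A₀ * B * W₀)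
    have s5 := degreeOf_sub_le x (A₀ * M₀ + X x * (A₀ * M' + D * M₀) + B * N₀ + X x * (B * N') - A₀ * B * W₀)
      (X x * (A₀ * B * W' + D * B * W₀))
    omega
  have hzero := eq_zero_of_X_sq_mul_eq hc0 hL key
  -- `D ≠ 0` since `x` is essential for `P₁`
  have hDne : D ≠ 0 := fun h0 => hx₁ ((ignores_iff_dsec_eq_zero x (ind P₁)).2 (exPoly_eq_zero_iff.1 h0))
  have := (mul_eq_zero.1 hzero).resolve_left hDne
  exact sub_eq_zero.1 this

end Identity

/-! ### THEOREM R₃ -/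

section Main

variable {P₁ P₂ : Set (Set ι)}

/-- Positivity of the expectation of a nonempty event at an interior parameter (plumbing). [folklore] -/
theorem ex_ind_pos {p : ι → unitInterval} (hp : ∀ i, (p i : ℝ) ∈ Set.Ioo (0 : ℝ) 1) {A : Set (Set ι)} (hA : A.Nonempty) :
    0 < ex (bernoulliWeight p) (ind A) := by
  obtain ⟨ω, hω⟩ := hA
  rw [ex]
  calc (0 : ℝ) < bernoulliWeight p ω * ind A ω := by rw [ind_of_mem hω, mul_one]; exact bernoulliWeight_pos hp ω
    _ ≤ ∑ x, bernoulliWeight p x * ind A x :=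
      single_le_sum (f := fun x => bernoulliWeight p x * ind A x)
        (fun x _ => mul_nonneg ((isFKGMeasure_bernoulliWeight p).nonneg x) (ind_nonneg _ _)) (mem_univ ω)

/-- `exPoly 1_A ≠ 0` for a nonempty event. [this work] -/
theorem exPoly_ind_ne_zero {A : Set (Set ι)} (hA : A.Nonempty) : exPoly (ind A) ≠ 0 := by
  obtain ⟨ω, hω⟩ := hA
  intro h
  have := exPoly_eq_zero_iff.1 h
  have := congrFun this ω
  rw [ind_of_mem hω] at this
  exact one_ne_zero this

/-- The identity hypothesis of R₃. [this work] -/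
def Identity (P₁ P₂ U : Set (Set ι)) : Prop :=
  ∀ p : ι → unitInterval, (∀ e, (p e : ℝ) ∈ Set.Ioo (0 : ℝ) 1) →
    ex (bernoulliWeight p) (ind P₁) * ex (bernoulliWeight p) (ind P₂ * ind U) +
      ex (bernoulliWeight p) (ind P₂) * ex (bernoulliWeight p) (ind P₁ * ind U) =
    ex (bernoulliWeight p) (ind P₁) * ex (bernoulliWeight p) (ind P₂) * ex (bernoulliWeight p) (ind U)

/-- **Step (a): no coordinate is essential for `P₁`, `P₂` and `U` simultaneously.** [this work] -/
theorem not_all_three (hP₁ : P₁.Nonempty) (hP₂ : P₂.Nonempty) {U : Set (Set ι)} (hU : U.Nonempty) (hI : Identity P₁ P₂ U) (y : ι)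
    (h1 : ¬ Ignores y (ind P₁)) (h2 : ¬ Ignores y (ind P₂)) (h3 : ¬ Ignores y (ind U)) : False := by
  have hid := poly_identity hI
  have hdeg : degreeOf y (exPoly (ind P₁) * exPoly (ind P₂) * exPoly (ind U)) = 3 := by
    rw [degreeOf_mul_eq (mul_ne_zero (exPoly_ind_ne_zero hP₁) (exPoly_ind_ne_zero hP₂)) (exPoly_ind_ne_zero hU),
      degreeOf_mul_eq (exPoly_ind_ne_zero hP₁) (exPoly_ind_ne_zero hP₂), degreeOf_exPoly_eq_one_of_not_ignores h1,
      degreeOf_exPoly_eq_one_of_not_ignores h2, degreeOf_exPoly_eq_one_of_not_ignores h3]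
  have hle : degreeOf y (exPoly (ind P₁) * exPoly (ind P₂ * ind U) + exPoly (ind P₂) * exPoly (ind P₁ * ind U)) ≤ 2 := by
    refine (degreeOf_add_le y _ _).trans (max_le ?_ ?_) <;>
      exact (degreeOf_mul_le y _ _).trans (Nat.add_le_add (degreeOf_exPoly_le _ y) (degreeOf_exPoly_le _ y))
  rw [hid, hdeg] at hle
  omega

/-- **The identity passes to the section `U^{x←1}`** when `x` is inessential for both `P_i`. [this work] -/
theorem identity_secAt {U : Set (Set ι)} (hI : Identity P₁ P₂ U) {x : ι} (hx₁ : Ignores x (ind P₁)) (hx₂ : Ignores x (ind P₂)) :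
    Identity P₁ P₂ (secAt x true U) := by
  have hid := poly_identity hI
  -- `1_{U^{x←1}} = fsec x true 1_U = fsec false + dsec`
  have hsec : ind (secAt x true U) = fsec x true (ind U) := by
    funext ω
    have hm : ω ∈ secAt x true U ↔ insert x ω ∈ U := mem_secAt
    simp only [fsec, forceAt, cond_true]
    by_cases hω : insert x ω ∈ U
    · rw [ind_of_mem (hm.2 hω), ind_of_mem hω]
    · rw [ind_of_not_mem fun h => hω (hm.1 h), ind_of_not_mem hω]
  set E1 := exPoly (ind P₁); set E2 := exPoly (ind P₂)
  set W₀ := exPoly (fsec x false (ind U)); set W' := exPoly (dsec x (ind U))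
  set M₀ := exPoly (ind P₂ * fsec x false (ind U)); set M' := exPoly (ind P₂ * dsec x (ind U))
  set N₀ := exPoly (ind P₁ * fsec x false (ind U)); set N' := exPoly (ind P₁ * dsec x (ind U))
  have hW : exPoly (ind U) = W₀ + X x * W' := by rw [exPoly_eq_fsec x (ind U)]; rfl
  have hM : exPoly (ind P₂ * ind U) = M₀ + X x * M' := by
    rw [exPoly_eq_fsec x (ind P₂ * ind U), fsec_mul_of_ignores false hx₂, fsec_mul_of_ignores true hx₂, ← mul_sub]; rfl
  have hN : exPoly (ind P₁ * ind U) = N₀ + X x * N' := by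
    rw [exPoly_eq_fsec x (ind P₁ * ind U), fsec_mul_of_ignores false hx₁, fsec_mul_of_ignores true hx₁, ← mul_sub]; rfl
  rw [hW, hM, hN] at hid
  have f0 : ∀ {g : Set ι → ℝ}, Ignores x g → degreeOf x (exPoly g) = 0 := fun hg => degreeOf_exPoly_eq_zero_of_ignores hg
  have hE10 : degreeOf x E1 = 0 := f0 hx₁
  have hE20 : degreeOf x E2 = 0 := f0 hx₂
  have hW₀0 : degreeOf x W₀ = 0 := f0 (ignores_fsec x false _)
  have hW'0 : degreeOf x W' = 0 := f0 (ignores_dsec x _)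
  have hM₀0 : degreeOf x M₀ = 0 := f0 (hx₂.mul (ignores_fsec x false _))
  have hM'0 : degreeOf x M' = 0 := f0 (hx₂.mul (ignores_dsec x _))
  have hN₀0 : degreeOf x N₀ = 0 := f0 (hx₁.mul (ignores_fsec x false _))
  have hN'0 : degreeOf x N' = 0 := f0 (hx₁.mul (ignores_dsec x _))
  -- the `X`-coefficient and the constant coefficient both vanish
  have key : X x * (E1 * M' + E2 * N' - E1 * E2 * W') = -(E1 * M₀ + E2 * N₀ - E1 * E2 * W₀) := by linear_combination hid
  have hc1 : degreeOf x (E1 * M' + E2 * N' - E1 * E2 * W') = 0 := by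
    refine Nat.eq_zero_of_le_zero ?_
    have := degreeOf_sub_le x (E1 * M' + E2 * N') (E1 * E2 * W'); have := degreeOf_add_le x (E1 * M') (E2 * N')
    have := degreeOf_mul_le x E1 M'; have := degreeOf_mul_le x E2 N'; have := degreeOf_mul_le x (E1 * E2) W'
    have := degreeOf_mul_le x E1 E2; omega
  have hc0 : degreeOf x (-(E1 * M₀ + E2 * N₀ - E1 * E2 * W₀)) = 0 := by
    rw [degreeOf_neg]; refine Nat.eq_zero_of_le_zero ?_
    have := degreeOf_sub_le x (E1 * M₀ + E2 * N₀) (E1 * E2 * W₀); have := degreeOf_add_le x (E1 * M₀) (E2 * N₀)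
    have := degreeOf_mul_le x E1 M₀; have := degreeOf_mul_le x E2 N₀; have := degreeOf_mul_le x (E1 * E2) W₀
    have := degreeOf_mul_le x E1 E2; omega
  have h1 : E1 * M' + E2 * N' - E1 * E2 * W' = 0 := eq_zero_of_X_mul_eq hc1 hc0 key
  have h0 : E1 * M₀ + E2 * N₀ - E1 * E2 * W₀ = 0 := by
    have := key; rw [h1, mul_zero] at this; exact (neg_eq_zero.1 this.symm)
  -- the identity for the `true`-section: `fsec true = fsec false + dsec`
  have hsum : fsec x true (ind U) = fsec x false (ind U) + dsec x (ind U) := by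
    funext ω; simp [dsec]
  intro p hp
  have hev := congrArg (MvPolynomial.eval fun i => (p i : ℝ)) (show E1 * exPoly (ind P₂ * fsec x true (ind U)) + E2 * exPoly (ind P₁ * fsec x true (ind U)) =
      E1 * E2 * exPoly (fsec x true (ind U)) from by
    rw [hsum, mul_add, mul_add, exPoly_add, exPoly_add, exPoly_add]
    linear_combination h0 + h1)
  simp only [E1, E2, map_add, map_mul, eval_exPoly] at hev
  rw [hsec]
  exact hev

end Main

end RigidityR3

end Summit.CriticalPhenomena.PercolationContinuityZ3.Theorems
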